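import Mathlib
import HarnessLib
import Literature.Analysis.FluidPDE.ClassicalSolution
import Literature.Analysis.FluidPDE.ClassicalSolutionCalculus
import Literature.Analysis.FluidPDE.LerayHopf
import Literature.Analysis.FluidPDE.SuitableWeak
import Summits.NavierStokesRegularity.NavierStokesRegularity.Theorems.QuarterJoltL4SliceTestCriterion
import Summits.NavierStokesRegularity.NavierStokesRegularity.Theorems.QuarterJoltWeakL4EnergyEquality

/-!
# Route QuarterJolt — crux `NoTerminalJolt` (stmt-NavierStokesRegularity-26463), LEAD line
# `regular_split` rev 8: THE SHINBROT–LIONS SCALE AT A FIRST BLOW-UP TIME, strong and weak in time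

Seat ns-ntj-p1 g6 (LEAD of the crux; `--supports 26463 --as helper`). Fourth file of the `L⁴`
SLICE-TEST CRITERION chain (`…SliceTestIncrementL4` p652191 → `…L4SliceTestCriterion` p652789 →
`…WeakL4EnergyEquality` → THIS). Frame: `(u,p)` classical on `[0,T)` (`ν, T > 0`), Leray–Hopf on
`[0,T]` from a rapidly decaying datum; `E₀ = E(u 0)`; exponents `p ≥ 4` (real),
`a = (p−4)/(p−2)`, `b = 2/(p−2)` (`a + b = 1`, `2a + pb = 4`).

1. `lintegral_enorm_rpow_four_le_interpolate` — `L²`–`L^p` INTERPOLATION onto `L⁴`: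
   `∫⁻‖f‖ₑ⁴ ≤ (∫⁻‖f‖ₑ²)^a (∫⁻‖f‖ₑ^p)^b` (Hölder with exponents summing to one, Mathlib's
   `ENNReal.lintegral_mul_norm_pow_le`).
2. `weakL4Rate_of_weakLpRate` — the WEAK SHINBROT RATE `∫⁻‖u(t)‖ₑ^p ≤ M(T−t)^{1−p/2}` near `T`,
   i.e. `‖u(t)‖_{L^p} ≤ M^{1/p}(T−t)^{−(1/2−1/p)}` (the rate of Cheskidov–Luo, Nonlinearity 33 (2020)
   Cor. 1.2), gives the weak-`L⁴` rate `∫‖u(t)‖⁴ ≤ (2E₀)^a M^b/(T−t)`; hence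
   `tendsto_integral_norm_sub_sq_of_weakLpRate`: NO ENERGY JUMP at `T` for every `p ≥ 4` — Cor. 1.2
   of Cheskidov–Luo (stated there for `p > 4` and the Besov norm `B⁰_{p,∞} ⊃ L^p`) at a first blow-up
   time of the frame, INCLUDING the endpoint `p = 4`, by elementary slice testing.
3. `tendsto_integral_norm_sub_sq_of_shinbrot` — SHINBROT'S CLASS `u ∈ L^q(t₀,T; L^p)`,
   `1/q + 1/p ≤ 1/2`, `p ≥ 4` (Shinbrot, SIAM J. Math. Anal. 5 (1974); `p = q = 4`: Lions, Rend. Sem.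
   Mat. Univ. Padova 30 (1960), `tendsto_integral_norm_sub_sq_of_L4L4`) ⇒ no energy jump at `T`:
   `ofReal ‖u(τ)‖²_{L⁴} ≤ (2E₀)^{a/2} Ψ(τ)`, `Ψ = (∫⁻‖u‖ₑ^p)^{b/2} = ‖u‖_p^{p/(p−2)}`, and Hölder in
   time with `r = q(p−2)/p ≥ 2`: `∫ₜᵀ Ψ ≤ ‖u‖_{L^qL^p(t₀,T)}^{q/r} (T−t)^{1−1/r} ≤ C√(T−t)` — the `L⁴`
   slice-test criterion (`tendsto_integral_norm_sub_sq_of_l4Criterion`, p652789).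

IN THE TREE: Lions' `L⁴L⁴` theorem for general weak solutions on `ℝ³`
(`Literature.Analysis.FluidPDE.lions_energy_equality_L4_holds`, Serrin's doubling) and on `T^d`
(`lions_energy_equality_Ioc'`); Shinbrot's `(p,q)` classes and the weak-in-time classes were not
in the tree. HONEST FRAMING: classical conditional criteria, restricted to the first-blow-up frame
of this route; nothing here claims progress on `NoTerminalJolt`, stmt-18118 or Navier–Stokes
regularity — all OPEN. No summit statement is proved here. [folklore]
-/

noncomputable section

-- the summit and its single sub-problem share the name (CONVENTIONS §1), as in every Theorems file
set_option linter.dupNamespace false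

namespace Summit.NavierStokesRegularity.NavierStokesRegularity.Theorems

open MeasureTheory Set Function Filter Topology InnerProductSpace
open scoped ENNReal NNReal ContDiff RealInnerProductSpace
open Literature.Analysis.FluidPDE

namespace NoTerminalJolt

/-! ### `L²`–`L^p` interpolation onto `L⁴` -/

/-- **Interpolation `‖f‖₄⁴ ≤ ‖f‖₂^{2a}‖f‖_p^{pb}`** in `lintegral` form: for `p ≥ 4`,
`a = (p−4)/(p−2)`, `b = 2/(p−2)`: `∫⁻‖f‖ₑ⁴ ≤ (∫⁻‖f‖ₑ²)^a · (∫⁻‖f‖ₑ^p)^b` (pointwise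
`‖f‖ₑ⁴ = (‖f‖ₑ²)^a(‖f‖ₑ^p)^b` since `2a + pb = 4`, then Hölder with `a + b = 1`,
`ENNReal.lintegral_mul_norm_pow_le`). [folklore] -/
theorem lintegral_enorm_rpow_four_le_interpolate {α : Type*} [MeasurableSpace α] {μ : Measure α}
    {E : Type*} [NormedAddCommGroup E] {f : α → E} (hf : AEStronglyMeasurable f μ)
    {p : ℝ} (hp : 4 ≤ p) :
    ∫⁻ x, ‖f x‖ₑ ^ (4 : ℝ) ∂μ ≤
      (∫⁻ x, ‖f x‖ₑ ^ (2 : ℝ) ∂μ) ^ ((p - 4) / (p - 2)) *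
        (∫⁻ x, ‖f x‖ₑ ^ p ∂μ) ^ (2 / (p - 2)) := by
  have hp2 : 0 < p - 2 := by linarith
  have ha : 0 ≤ (p - 4) / (p - 2) := div_nonneg (by linarith) hp2.le
  have hb : 0 ≤ 2 / (p - 2) := div_nonneg (by norm_num) hp2.le
  have hab : (p - 4) / (p - 2) + 2 / (p - 2) = 1 := by
    rw [← add_div, show p - 4 + 2 = p - 2 by ring, div_self hp2.ne']
  have hexp : (2 : ℝ) * ((p - 4) / (p - 2)) + p * (2 / (p - 2)) = 4 := by
    rw [mul_div_assoc', mul_div_assoc', ← add_div, div_eq_iff hp2.ne']; ring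
  have hpt : ∀ x, ‖f x‖ₑ ^ (4 : ℝ) =
      (‖f x‖ₑ ^ (2 : ℝ)) ^ ((p - 4) / (p - 2)) * (‖f x‖ₑ ^ p) ^ (2 / (p - 2)) := by
    intro x
    rw [← ENNReal.rpow_mul, ← ENNReal.rpow_mul, ← ENNReal.rpow_add_of_nonneg _ _
      (mul_nonneg (by norm_num) ha) (mul_nonneg (by linarith) hb), hexp]
  calc ∫⁻ x, ‖f x‖ₑ ^ (4 : ℝ) ∂μ
      = ∫⁻ x, (‖f x‖ₑ ^ (2 : ℝ)) ^ ((p - 4) / (p - 2)) * (‖f x‖ₑ ^ p) ^ (2 / (p - 2)) ∂μ :=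
        lintegral_congr fun x => hpt x
    _ ≤ (∫⁻ x, ‖f x‖ₑ ^ (2 : ℝ) ∂μ) ^ ((p - 4) / (p - 2)) *
        (∫⁻ x, ‖f x‖ₑ ^ p ∂μ) ^ (2 / (p - 2)) :=
        ENNReal.lintegral_mul_norm_pow_le (hf.enorm.pow_const _) (hf.enorm.pow_const _) ha hb hab

/-- `∫‖v‖⁴ = (∫⁻‖v‖ₑ^{(4:ℝ)}).toReal` for a continuous field (Bochner vs. lower integral; the
`lintegral` may be infinite, in which case both sides vanish). [folklore] -/
theorem integral_norm_pow_four_eq_toReal {v : EuclideanSpace ℝ (Fin 3) → EuclideanSpace ℝ (Fin 3)}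
    (hv : Continuous v) :
    ∫ x, ‖v x‖ ^ 4 = (∫⁻ x, ‖v x‖ₑ ^ (4 : ℝ)).toReal := by
  have h1 : 0 ≤ᵐ[volume] fun x => ‖v x‖ ^ 4 :=
    Eventually.of_forall fun x => by simp only [Pi.zero_apply]; positivity
  have h2 : AEStronglyMeasurable (fun x => ‖v x‖ ^ 4) volume := (hv.norm.pow 4).aestronglyMeasurable
  rw [integral_eq_lintegral_of_nonneg_ae h1 h2]
  congr 1
  refine lintegral_congr fun x => ?_
  rw [← ofReal_norm, ENNReal.ofReal_pow (norm_nonneg _), ← ENNReal.rpow_natCast]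
  norm_num

/-! ### The weak Shinbrot rate ⇒ the weak `L⁴` rate ⇒ no energy jump -/

/-- **Weak `L^p` rate ⇒ weak `L⁴` rate.** In the frame (classical on `[0,T)`, Leray–Hopf on
`[0,T]`, `ν > 0`), if `∫⁻‖u(t)‖ₑ^p ≤ ofReal (M(T−t)^{1−p/2})` for `t < T` near `T` (`p ≥ 4`,
`M ≥ 0`; i.e. `‖u(t)‖_{L^p} ≲ (T−t)^{−(1/2−1/p)}`), then
`∫‖u(t)‖⁴ ≤ (2E(u 0))^{(p−4)/(p−2)} M^{2/(p−2)}/(T−t)` near `T` (interpolation with the Leray–Hopf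
energy bound `∫‖u(t)‖² ≤ 2E(u 0)`; `(1 − p/2)·2/(p−2) = −1`). In the signature the space exponent is
called `q` (`p` being the pressure). [folklore] -/
theorem weakL4Rate_of_weakLpRate {ν T : ℝ} (hν : 0 < ν) (hT : 0 < T)
    {u : ℝ → EuclideanSpace ℝ (Fin 3) → EuclideanSpace ℝ (Fin 3)} {p : ℝ → EuclideanSpace ℝ (Fin 3) → ℝ}
    (hcl : IsClassicalNSSolutionOn (Ico 0 T) ν 0 u p) (hLH : IsLerayHopfOn T ν 0 (u 0) u)
    {q : ℝ} (hq : 4 ≤ q) {M : ℝ} (hM : 0 ≤ M)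
    (hrate : ∀ᶠ t in 𝓝[<] T, ∫⁻ x, ‖u t x‖ₑ ^ q ≤ ENNReal.ofReal (M * (T - t) ^ (1 - q / 2))) :
    ∀ᶠ t in 𝓝[<] T, ∫ x, ‖u t x‖ ^ 4 ≤
      (2 * VectorCalculus.kineticEnergy (u 0)) ^ ((q - 4) / (q - 2)) * M ^ (2 / (q - 2)) / (T - t) := by
  set E₀ : ℝ := VectorCalculus.kineticEnergy (u 0) with hE₀
  have hE₀0 : 0 ≤ E₀ := kineticEnergy_nonneg (u 0)
  have hq2 : 0 < q - 2 := by linarith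
  have ha : 0 ≤ (q - 4) / (q - 2) := div_nonneg (by linarith) hq2.le
  have hb : 0 ≤ 2 / (q - 2) := div_nonneg (by norm_num) hq2.le
  have hwin : ∀ᶠ t in 𝓝[<] T, t ∈ Ioo 0 T := Ioo_mem_nhdsLT hT
  filter_upwards [hrate, hwin] with t ht htI
  have hTt : 0 < T - t := sub_pos.2 htI.2
  have hc : Continuous (u t) := (hcl.contDiff_velocity ⟨htI.1.le, htI.2⟩).continuous
  -- the energy bound in `rpow` form
  have hE2 : ∫⁻ x, ‖u t x‖ₑ ^ (2 : ℝ) ≤ ENNReal.ofReal (2 * E₀) := by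
    have h := hLH.lintegral_enorm_sq_le hν.le ⟨htI.1.le, htI.2.le⟩
    refine le_trans (le_of_eq (lintegral_congr fun x => ?_)) h
    rw [ENNReal.rpow_two]
  -- interpolation
  have hint := lintegral_enorm_rpow_four_le_interpolate (μ := volume) hc.aestronglyMeasurable hq
  have hB : ∫⁻ x, ‖u t x‖ₑ ^ (4 : ℝ) ≤
      ENNReal.ofReal ((2 * E₀) ^ ((q - 4) / (q - 2)) * (M ^ (2 / (q - 2)) / (T - t))) := by
    refine hint.trans ?_
    have h1 : (∫⁻ x, ‖u t x‖ₑ ^ (2 : ℝ)) ^ ((q - 4) / (q - 2)) ≤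
        ENNReal.ofReal ((2 * E₀) ^ ((q - 4) / (q - 2))) := by
      rw [← ENNReal.ofReal_rpow_of_nonneg (by positivity) ha]
      exact ENNReal.rpow_le_rpow hE2 ha
    have h2 : (∫⁻ x, ‖u t x‖ₑ ^ q) ^ (2 / (q - 2)) ≤ ENNReal.ofReal (M ^ (2 / (q - 2)) / (T - t)) := by
      have h3 := ENNReal.rpow_le_rpow ht hb
      refine h3.trans (le_of_eq ?_)
      rw [ENNReal.ofReal_rpow_of_nonneg (mul_nonneg hM (Real.rpow_nonneg hTt.le _)) hb,
        Real.mul_rpow hM (Real.rpow_nonneg hTt.le _), ← Real.rpow_mul hTt.le]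
      have he : (1 - q / 2) * (2 / (q - 2)) = -1 := by
        rw [mul_div_assoc', div_eq_iff hq2.ne']; ring
      rw [he, Real.rpow_neg_one]
      simp only [div_eq_mul_inv]
    calc (∫⁻ x, ‖u t x‖ₑ ^ (2 : ℝ)) ^ ((q - 4) / (q - 2)) * (∫⁻ x, ‖u t x‖ₑ ^ q) ^ (2 / (q - 2))
        ≤ ENNReal.ofReal ((2 * E₀) ^ ((q - 4) / (q - 2))) *
            ENNReal.ofReal (M ^ (2 / (q - 2)) / (T - t)) := mul_le_mul' h1 h2
      _ = ENNReal.ofReal ((2 * E₀) ^ ((q - 4) / (q - 2)) * (M ^ (2 / (q - 2)) / (T - t))) := by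
          rw [← ENNReal.ofReal_mul (by positivity)]
  have hpos : 0 ≤ (2 * E₀) ^ ((q - 4) / (q - 2)) * (M ^ (2 / (q - 2)) / (T - t)) := by positivity
  rw [integral_norm_pow_four_eq_toReal hc]
  calc (∫⁻ x, ‖u t x‖ₑ ^ (4 : ℝ)).toReal
      ≤ (ENNReal.ofReal ((2 * E₀) ^ ((q - 4) / (q - 2)) * (M ^ (2 / (q - 2)) / (T - t)))).toReal :=
        ENNReal.toReal_mono ENNReal.ofReal_ne_top hB
    _ = (2 * E₀) ^ ((q - 4) / (q - 2)) * M ^ (2 / (q - 2)) / (T - t) := by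
        rw [ENNReal.toReal_ofReal hpos]; ring

/-- **A FIRST BLOW-UP WITH `‖u(t)‖_{L^p} ≲ (T−t)^{−(1/2−1/p)}`, `p ≥ 4`, HAS NO ENERGY JUMP**
(Cheskidov–Luo, Nonlinearity 33 (2020) Cor. 1.2 — there for `p > 4` in `B⁰_{p,∞}` — at a first
blow-up time of the frame, including the endpoint `p = 4`). `(u,p)` classical on `[0,T)`
(`ν, T > 0`), Leray–Hopf on `[0,T]` from a rapidly decaying datum, `p ≥ 4`, `M ≥ 0`, and
`∫⁻‖u(t)‖ₑ^p ≤ ofReal (M(T−t)^{1−p/2})` for `t < T` near `T`. Then `∫‖u(t) − u(T)‖² → 0` as `t ↑ T`.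
(`p = ∞`, the sup-norm Type-I rate, is `tendsto_integral_norm_sub_sq_of_isTypeIBlowup`, p639359.
In the signature the space exponent is called `q`, `p` being the pressure.) [folklore] -/
theorem tendsto_integral_norm_sub_sq_of_weakLpRate {ν T : ℝ} (hν : 0 < ν) (hT : 0 < T)
    {u : ℝ → EuclideanSpace ℝ (Fin 3) → EuclideanSpace ℝ (Fin 3)} {p : ℝ → EuclideanSpace ℝ (Fin 3) → ℝ}
    (hcl : IsClassicalNSSolutionOn (Ico 0 T) ν 0 u p) (hLH : IsLerayHopfOn T ν 0 (u 0) u)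
    (hdec : HasRapidSpatialDecay (u 0)) {q : ℝ} (hq : 4 ≤ q) {M : ℝ} (hM : 0 ≤ M)
    (hrate : ∀ᶠ t in 𝓝[<] T, ∫⁻ x, ‖u t x‖ₑ ^ q ≤ ENNReal.ofReal (M * (T - t) ^ (1 - q / 2))) :
    Tendsto (fun t => ∫ x, ‖u t x - u T x‖ ^ 2) (𝓝[<] T) (𝓝 0) :=
  tendsto_integral_norm_sub_sq_of_weakL4Rate hν hT hcl hLH hdec
    (weakL4Rate_of_weakLpRate hν hT hcl hLH hq hM hrate)

/-- **Weak `L^p` rate ⇒ no energy jump, `eLpNorm` form** (the conclusion shape of the former stub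
`stub_typeIIEnergyEquality`; composes with `noFastEnergyConcentration_of_…` /
`noEnergyAtom_of_tendsto_eLpNorm_sub` exactly as in file III). [folklore] -/
theorem tendsto_eLpNorm_sub_of_weakLpRate {ν T : ℝ} (hν : 0 < ν) (hT : 0 < T)
    {u : ℝ → EuclideanSpace ℝ (Fin 3) → EuclideanSpace ℝ (Fin 3)} {p : ℝ → EuclideanSpace ℝ (Fin 3) → ℝ}
    (hcl : IsClassicalNSSolutionOn (Ico 0 T) ν 0 u p) (hLH : IsLerayHopfOn T ν 0 (u 0) u)
    (hdec : HasRapidSpatialDecay (u 0)) {q : ℝ} (hq : 4 ≤ q) {M : ℝ} (hM : 0 ≤ M)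
    (hrate : ∀ᶠ t in 𝓝[<] T, ∫⁻ x, ‖u t x‖ₑ ^ q ≤ ENNReal.ofReal (M * (T - t) ^ (1 - q / 2))) :
    Tendsto (fun t => eLpNorm (u t - u T) 2 volume) (𝓝[<] T) (𝓝 0) :=
  (tendsto_eLpNorm_sub_iff_tendsto_integral_norm_sub_sq hT hLH).2
    (tendsto_integral_norm_sub_sq_of_weakLpRate hν hT hcl hLH hdec hq hM hrate)

/-! ### Shinbrot's class `L^q_t L^p_x`, `1/q + 1/p ≤ 1/2`, `p ≥ 4` -/

/-- **SHINBROT'S CLASS AT A FIRST BLOW-UP TIME** (Shinbrot, SIAM J. Math. Anal. 5 (1974), Thm.;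
`p = q = 4`: Lions 1960; here in the first-blow-up frame by slice testing). `(u,p)` classical on
`[0,T)` (`ν, T > 0`), Leray–Hopf on `[0,T]` from a rapidly decaying datum; exponents `p ≥ 4`, `q > 0`
with `1/q + 1/p ≤ 1/2`; and `u ∈ L^q(t₀,T; L^p)`: `∫⁻_{(t₀,T)} (∫⁻‖u(t)‖ₑ^p)^{q/p} dt < ∞` for some
`t₀ ∈ [0,T)`. Then `∫‖u(t) − u(T)‖² → 0` as `t ↑ T` (no energy jump ⟺ Leray's energy equality on
`[0,T]`). Proof: `ofReal ‖u(τ)‖²_{L⁴} ≤ (ofReal 2E₀)^{a/2}·(∫⁻‖u(τ)‖ₑ^p)^{b/2}` (interpolation), Hölder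
in time with `ρ = q(p−2)/p ≥ 2` and `|(t,T)|^{1−1/ρ} ≤ T^{1/2−1/ρ}√(T−t)`, then the `L⁴`
slice-test criterion. (In the signature the exponents `(p,q)` are called `(r,s)`, `p` being the
pressure.) [folklore] -/
theorem tendsto_integral_norm_sub_sq_of_shinbrot {ν T : ℝ} (hν : 0 < ν) (hT : 0 < T)
    {u : ℝ → EuclideanSpace ℝ (Fin 3) → EuclideanSpace ℝ (Fin 3)} {p : ℝ → EuclideanSpace ℝ (Fin 3) → ℝ}
    (hcl : IsClassicalNSSolutionOn (Ico 0 T) ν 0 u p) (hLH : IsLerayHopfOn T ν 0 (u 0) u)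
    (hdec : HasRapidSpatialDecay (u 0)) {r s : ℝ} (hr : 4 ≤ r) (hs : 0 < s)
    (hrs : 1 / s + 1 / r ≤ 1 / 2) {t₀ : ℝ} (ht₀ : t₀ ∈ Ico 0 T)
    (hfin : ∫⁻ t in Ioo t₀ T, (∫⁻ x, ‖u t x‖ₑ ^ r) ^ (s / r) ≠ ⊤) :
    Tendsto (fun t => ∫ x, ‖u t x - u T x‖ ^ 2) (𝓝[<] T) (𝓝 0) := by
  -- exponents
  set E₀ : ℝ := VectorCalculus.kineticEnergy (u 0) with hE₀
  have hE₀0 : 0 ≤ E₀ := kineticEnergy_nonneg (u 0)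
  have hr0 : 0 < r := by linarith
  have hr2 : 0 < r - 2 := by linarith
  set a : ℝ := (r - 4) / (r - 2) with hadef
  set b : ℝ := 2 / (r - 2) with hbdef
  have ha : 0 ≤ a := div_nonneg (by linarith) hr2.le
  have hb : 0 ≤ b := div_nonneg (by norm_num) hr2.le
  -- the time exponent `ρ = s(r−2)/r ≥ 2` (Shinbrot's condition `1/s + 1/r ≤ 1/2`)
  set ρ : ℝ := s * (r - 2) / r with hρdef
  have key : 2 * r ≤ s * (r - 2) := by
    have h := hrs
    rw [div_add_div _ _ hs.ne' hr0.ne', div_le_div_iff₀ (mul_pos hs hr0) two_pos] at h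
    nlinarith
  have hρ2 : 2 ≤ ρ := by
    rw [hρdef, le_div_iff₀ hr0]; linarith
  have hρ1 : 1 < ρ := by linarith
  have hρ0 : 0 < ρ := by linarith
  set ρ' : ℝ := Real.conjExponent ρ with hρ'def
  have hconj : ρ.HolderConjugate ρ' := Real.HolderConjugate.conjExponent hρ1
  have hρ'0 : 0 < ρ' := hconj.symm.pos
  have hγ : 0 ≤ 1 / ρ' - 1 / 2 := by
    have hρinv : ρ⁻¹ ≤ (2 : ℝ)⁻¹ := inv_anti₀ two_pos hρ2
    rw [one_div, ← hconj.one_sub_inv, one_div]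
    linarith
  have hbρ : b / 2 * ρ = s / r := by
    rw [hbdef, hρdef]
    field_simp
    try ring
  -- the `L^sL^r` constant
  set I : ℝ≥0∞ := ∫⁻ t in Ioo t₀ T, (∫⁻ x, ‖u t x‖ₑ ^ r) ^ (s / r) with hIdef
  set K : ℝ := (2 * E₀) ^ (a / 2) with hKdef
  have hK0 : 0 ≤ K := by positivity
  set C : ℝ := K * ((I.toReal) ^ (1 / ρ) * T ^ (1 / ρ' - 1 / 2)) with hCdef
  have hC0 : 0 ≤ C := by positivity
  refine tendsto_integral_norm_sub_sq_of_l4Criterion hν hT hcl hLH hdec hC0 ?_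
  have hwin : ∀ᶠ t in 𝓝[<] T, t ∈ Ioo t₀ T := Ioo_mem_nhdsLT ht₀.2
  filter_upwards [hwin] with t htI
  have ht0 : 0 ≤ t := ht₀.1.trans htI.1.le
  have hTt : 0 < T - t := sub_pos.2 htI.2
  -- the moving `L^r` functional and its measurability on `(t,T)`
  set Ψ : ℝ → ℝ≥0∞ := fun τ => (∫⁻ x, ‖u τ x‖ₑ ^ r) ^ (b / 2) with hΨdef
  have hsub : Ioo t T ⊆ Ico 0 T := fun τ hτ => ⟨ht0.trans hτ.1.le, hτ.2⟩
  have hmeasU : AEStronglyMeasurable (uncurry u) ((volume.restrict (Ioo t T)).prod volume) := by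
    rw [Measure.restrict_prod_eq_prod_univ]
    exact (hcl.smooth_velocity.continuousOn.mono (prod_mono hsub Subset.rfl)).aestronglyMeasurable
      (measurableSet_Ioo.prod MeasurableSet.univ)
  have hΨm : AEMeasurable Ψ (volume.restrict (Ioo t T)) :=
    ((hmeasU.enorm.pow_const r).lintegral_prod_right').pow_const _
  -- pointwise: `ofReal √(∫‖u τ‖⁴) ≤ ofReal K * Ψ τ`
  have hpt : ∀ τ ∈ Ioo t T, ENNReal.ofReal (Real.sqrt (∫ x, ‖u τ x‖ ^ 4)) ≤
      ENNReal.ofReal K * Ψ τ := by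
    intro τ hτ
    have hτI : τ ∈ Ico 0 T := hsub hτ
    have hc : Continuous (u τ) := (hcl.contDiff_velocity hτI).continuous
    set L : ℝ≥0∞ := ∫⁻ x, ‖u τ x‖ₑ ^ (4 : ℝ) with hL
    -- `ofReal √(∫‖u‖⁴) ≤ L^{1/2}`
    have h1 : ENNReal.ofReal (Real.sqrt (∫ x, ‖u τ x‖ ^ 4)) ≤ L ^ (1 / 2 : ℝ) := by
      rw [integral_norm_pow_four_eq_toReal hc, Real.sqrt_eq_rpow, ENNReal.toReal_rpow]
      exact ENNReal.ofReal_toReal_le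
    -- interpolation and the energy bound
    have hE2 : ∫⁻ x, ‖u τ x‖ₑ ^ (2 : ℝ) ≤ ENNReal.ofReal (2 * E₀) := by
      have h := hLH.lintegral_enorm_sq_le hν.le ⟨hτI.1, hτI.2.le⟩
      refine le_trans (le_of_eq (lintegral_congr fun x => ?_)) h
      rw [ENNReal.rpow_two]
    have h2 : L ^ (1 / 2 : ℝ) ≤ ENNReal.ofReal K * Ψ τ := by
      have hint := lintegral_enorm_rpow_four_le_interpolate (μ := volume) hc.aestronglyMeasurable hr
      have h3 := ENNReal.rpow_le_rpow hint (by norm_num : (0:ℝ) ≤ 1 / 2)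
      refine h3.trans ?_
      rw [ENNReal.mul_rpow_of_nonneg _ _ (by norm_num : (0:ℝ) ≤ 1 / 2), ← ENNReal.rpow_mul,
        ← ENNReal.rpow_mul]
      have e1 : (r - 4) / (r - 2) * (1 / 2) = a / 2 := by rw [hadef]; ring
      have e2 : 2 / (r - 2) * (1 / 2 : ℝ) = b / 2 := by rw [hbdef]; ring
      rw [e1, e2]
      refine mul_le_mul' ?_ le_rfl
      rw [hKdef, ← ENNReal.ofReal_rpow_of_nonneg (by positivity) (by positivity)]
      exact ENNReal.rpow_le_rpow hE2 (by positivity)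
    exact h1.trans h2
  -- Hölder in time on `(t,T)`
  have hvol : ∫⁻ τ in Ioo t T, (fun _ => (1 : ℝ≥0∞)) τ ^ ρ' = ENNReal.ofReal (T - t) := by
    have h1 : (fun τ : ℝ => (fun _ : ℝ => (1 : ℝ≥0∞)) τ ^ ρ') = fun _ => 1 := by
      funext τ; exact ENNReal.one_rpow ρ'
    rw [h1, setLIntegral_const, one_mul, Real.volume_Ioo]
  have hΨρ : ∫⁻ τ in Ioo t T, Ψ τ ^ ρ ≤ I := by
    calc ∫⁻ τ in Ioo t T, Ψ τ ^ ρ = ∫⁻ τ in Ioo t T, (∫⁻ x, ‖u τ x‖ₑ ^ r) ^ (s / r) :=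
          lintegral_congr fun τ => by simp only [hΨdef]; rw [← ENNReal.rpow_mul, hbρ]
      _ ≤ I := lintegral_mono_set (Ioo_subset_Ioo_left htI.1.le)
  have hH : ∫⁻ τ in Ioo t T, Ψ τ ≤ I ^ (1 / ρ) * ENNReal.ofReal ((T - t) ^ (1 / ρ')) := by
    have h := ENNReal.lintegral_mul_le_Lp_mul_Lq (volume.restrict (Ioo t T)) hconj hΨm
      (aemeasurable_const (b := (1 : ℝ≥0∞)))
    have hleft : ∫⁻ τ in Ioo t T, Ψ τ = ∫⁻ τ in Ioo t T, (Ψ * (fun _ : ℝ => (1 : ℝ≥0∞))) τ :=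
      lintegral_congr fun τ => by simp only [Pi.mul_apply, mul_one]
    rw [hleft]
    refine h.trans ?_
    rw [hvol, ENNReal.ofReal_rpow_of_nonneg hTt.le (by positivity)]
    exact mul_le_mul' (ENNReal.rpow_le_rpow hΨρ (by positivity)) le_rfl
  -- assemble
  have hIfin : I ^ (1 / ρ) ≠ ⊤ := ENNReal.rpow_ne_top_of_nonneg (by positivity) hfin
  have hIeq : I ^ (1 / ρ) = ENNReal.ofReal (I.toReal ^ (1 / ρ)) := by
    rw [ENNReal.toReal_rpow, ENNReal.ofReal_toReal hIfin]
  have hI0 : 0 ≤ I.toReal ^ (1 / ρ) := by positivity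
  have hpow : (T - t) ^ (1 / ρ') ≤ T ^ (1 / ρ' - 1 / 2) * Real.sqrt (T - t) := by
    have e : (T - t) ^ (1 / ρ') = (T - t) ^ (1 / ρ' - 1 / 2) * (T - t) ^ (1 / 2 : ℝ) := by
      rw [← Real.rpow_add hTt]; congr 1; ring
    rw [e, Real.sqrt_eq_rpow]
    refine mul_le_mul_of_nonneg_right (Real.rpow_le_rpow hTt.le (by linarith [ht0]) hγ)
      (Real.rpow_nonneg hTt.le _)
  have hT0 : 0 ≤ T ^ (1 / ρ' - 1 / 2) * Real.sqrt (T - t) := by positivity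
  calc ∫⁻ τ in Ioo t T, ENNReal.ofReal (Real.sqrt (∫ x, ‖u τ x‖ ^ 4))
      ≤ ∫⁻ τ in Ioo t T, ENNReal.ofReal K * Ψ τ :=
        setLIntegral_mono' measurableSet_Ioo fun τ hτ => hpt τ hτ
    _ = ENNReal.ofReal K * ∫⁻ τ in Ioo t T, Ψ τ :=
        lintegral_const_mul' _ _ ENNReal.ofReal_ne_top
    _ ≤ ENNReal.ofReal K * (I ^ (1 / ρ) * ENNReal.ofReal ((T - t) ^ (1 / ρ'))) :=
        mul_le_mul' le_rfl hH
    _ ≤ ENNReal.ofReal K * (I ^ (1 / ρ) * ENNReal.ofReal (T ^ (1 / ρ' - 1 / 2) * Real.sqrt (T - t))) :=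
        mul_le_mul' le_rfl (mul_le_mul' le_rfl (ENNReal.ofReal_le_ofReal hpow))
    _ = ENNReal.ofReal (C * Real.sqrt (T - t)) := by
        rw [hIeq, ← ENNReal.ofReal_mul hI0, ← ENNReal.ofReal_mul hK0, hCdef]
        congr 1; ring

/-- **LIONS' CLASS `L⁴(t₀,T; L⁴)` AT A FIRST BLOW-UP TIME** (J.-L. Lions, Rend. Sem. Mat. Univ. Padova
30 (1960); the case `p = q = 4` of `tendsto_integral_norm_sub_sq_of_shinbrot`; for general weak
solutions on `ℝ³` the tree has `Literature.Analysis.FluidPDE.lions_energy_equality_L4_holds`): in the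
frame, `∫⁻_{(t₀,T)}∫⁻‖u‖ₑ⁴ < ∞` for some `t₀ ∈ [0,T)` forces `∫‖u(t) − u(T)‖² → 0` as `t ↑ T`. [folklore] -/
theorem tendsto_integral_norm_sub_sq_of_L4L4 {ν T : ℝ} (hν : 0 < ν) (hT : 0 < T)
    {u : ℝ → EuclideanSpace ℝ (Fin 3) → EuclideanSpace ℝ (Fin 3)} {p : ℝ → EuclideanSpace ℝ (Fin 3) → ℝ}
    (hcl : IsClassicalNSSolutionOn (Ico 0 T) ν 0 u p) (hLH : IsLerayHopfOn T ν 0 (u 0) u)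
    (hdec : HasRapidSpatialDecay (u 0)) {t₀ : ℝ} (ht₀ : t₀ ∈ Ico 0 T)
    (hfin : ∫⁻ t in Ioo t₀ T, ∫⁻ x, ‖u t x‖ₑ ^ 4 ≠ ⊤) :
    Tendsto (fun t => ∫ x, ‖u t x - u T x‖ ^ 2) (𝓝[<] T) (𝓝 0) := by
  refine tendsto_integral_norm_sub_sq_of_shinbrot hν hT hcl hLH hdec (r := 4) (s := 4) le_rfl
    (by norm_num) (by norm_num) ht₀ ?_
  have heq : ∀ τ, (∫⁻ x, ‖u τ x‖ₑ ^ (4 : ℝ)) ^ ((4 : ℝ) / 4) = ∫⁻ x, ‖u τ x‖ₑ ^ 4 := by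
    intro τ
    rw [div_self (by norm_num : (4:ℝ) ≠ 0), ENNReal.rpow_one]
    exact lintegral_congr fun x => by
      rw [← ENNReal.rpow_natCast]; norm_num
  simp_rw [heq]
  exact hfin

end NoTerminalJolt

end Summit.NavierStokesRegularity.NavierStokesRegularity.Theorems

end
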